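import Summits.Ventures.CertifiedArithmetic.LowPrec.UfpN

/-!
# The Lange–Rump height bound for the formats: any-order summation error `≤ h·u·Σ|xᵢ|`

HONEST FRAMING (venture CertifiedArithmetic / cell `pub-lowprec`): certified error envelopes and
provably optimal rounding/accumulation schemes for low-precision formats under stated cost models;
every table by two implementations; no hardware or vendor claims.

THE THEOREM (Lange–Rump, *Sharp estimates for perturbation errors in summations*, Math. Comp. 88
(2019) [LangeRump2018, Prop 3 (round-to-nearest case)], quoted as [BoldoEtAl2023, Thm 4.4]): for
`x₁ … xₙ ∈ F`, round-to-nearest and any summation ordering whose binary tree has height `h` with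
`h ≤ u^{-1/2} - 1`, `|ŝ - s| ≤ h·u·Σ|xᵢ|` — the classical factor `(1+u)^h - 1`
(`AccumulateTree.lean`) replaced by its linear term; for pairwise summation `h = ⌈log₂ n⌉`.

PROVED HERE for the venture's bit-level formats (`roundNE α`; every format with `emaxCode ≥ 2`;
leaves in `F_α`; nodes in range; hypothesis written `(h+1)²·u ≤ 1`): local-error form
`Σ_nodes |e_v| ≤ h·u·Σ|xᵢ|` (`absErr_flα_le_height_langeRump`) and
`|ŝ - s| ≤ h·u·Σ|xᵢ|` (`abs_eval_sub_exact_le_height_langeRump`).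

THE PROOF is the paper's (its Theorem 7, binary trees, radix 2, `c_h = β⁻¹ - β⁻² = 1/4`,
`ε = b = u`): induction on the height with the strengthened hypothesis (25)
`Σ|e| ≤ h·u·T - (η - h)·max(b_r - u·T, 0)` where `T = Σ|xᵢ|`, `η` is any number with
`(η+1)²u ≤ 1` and `b_r = u·ufp` at the root; three cases (`b_r ≤ uT`; `b_r ≤ b_p + b_q`; else the
discreteness `b_p + b_q ≤ ¾ b_r` of [LangeRump2018, (27)] plus the two-level bound and AM–GM
`(η - h + 2)(h - 1) ≤ (η+1)²/4`). ONE DEVIATION, deliberately: the paper instantiates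
`b_j = u·ufp(s_j)` with `s_j` the COMPUTED value of node `j`; its inequality (22)
`b_j ≤ u·(Σ_{leaves}|xᵢ| + Σ_{below j}|eᵢ|)` then fails when `s_j` is a power of two reached by
rounding up (e.g. `½ + (½ - u/2) ↦ 1` under ties-to-even: `b_j = u`, right side `u(1 - u/2)`). We
use `b_j = u·ufpN(y_j)` with `y_j` the node's exact ARGUMENT (`UfpN.lean`), for which both
`|e_j| ≤ b_j` and `b_j ≤ u·|y_j| ≤ u·(T_j + Σ_{below j}|eᵢ|)` hold; the rest is verbatim.

Not here: faithful/directed rounding (the paper's `2u` version; RZ any order is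
`AccumulateDirected.lean` without height restriction), the `hu/(1+u)` refinement (paper, Remark 8),
necessity of the height restriction (paper, Lemma 9 / Fig. 1).
-/

namespace Literature.ComputerArithmetic.FloatingPoint

namespace MiniFloat

open Literature.ComputerArithmetic.JeannerodRump2018
open Literature.ComputerArithmetic.JeannerodRump2018.SumTree

variable {α : Format}

/-! ### Discreteness of the binade floors: two children below a parent sum to at most `3/4` -/

/-- Quadrupling order: `2·ufpN y < ufpN y'` forces `4·ufpN y ≤ ufpN y'`. [folklore] -/
theorem four_mul_ufpN_le_of_lt {y y' : ℚ} (hlt : 2 * ufpN α y < ufpN α y') :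
    4 * ufpN α y ≤ ufpN α y' := by
  have hq := α.quantum_pos
  unfold ufpN at hlt ⊢
  split_ifs at hlt ⊢ with h1 h2 h2
  · simp at hlt
  · rw [mul_zero]; positivity
  · exfalso
    have : (0 : ℚ) ≤ 2 ^ (α.manBits + α.shift ⌊|y| / α.quantum⌋.toNat) * α.quantum := by positivity
    linarith
  · set s := α.shift ⌊|y| / α.quantum⌋.toNat
    set s' := α.shift ⌊|y'| / α.quantum⌋.toNat
    have hlt' : (2 : ℚ) ^ (α.manBits + s + 1) < 2 ^ (α.manBits + s') := by
      rw [pow_succ]; nlinarith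
    have hss : α.manBits + s + 1 < α.manBits + s' :=
      (pow_lt_pow_iff_right₀ (by norm_num : (1 : ℚ) < 2)).mp hlt'
    have hle : (2 : ℚ) ^ (α.manBits + s + 2) ≤ 2 ^ (α.manBits + s') :=
      pow_le_pow_right₀ (by norm_num) (by omega)
    rw [pow_add _ (α.manBits + s) 2] at hle
    nlinarith

/-- [LangeRump2018, (27)] for binary trees in radix 2: if the children's floors sum to less than the
parent's, they sum to at most `3/4` of it (`c_h = β⁻¹ - β⁻² = 1/4`). [cite: LangeRump2018, (27)] -/
theorem ufpN_add_ufpN_le_of_lt {a b c : ℚ} (hlt : ufpN α a + ufpN α b < ufpN α c) :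
    ufpN α a + ufpN α b ≤ 3 / 4 * ufpN α c := by
  have ha := ufpN_nonneg α a
  have hb := ufpN_nonneg α b
  -- the larger child is ≤ c/2; if strictly, it is ≤ c/4; else the smaller is ≤ c/4
  rcases le_total (ufpN α a) (ufpN α b) with hab | hab
  · have h2 := two_mul_ufpN_le_of_lt (lt_of_le_of_lt (by linarith) hlt : ufpN α b < ufpN α c)
    rcases lt_or_eq_of_le h2 with hlt2 | heq2
    · have := four_mul_ufpN_le_of_lt hlt2; linarith
    · have hlt3 : ufpN α a < ufpN α b := by linarith
      have := two_mul_ufpN_le_of_lt hlt3; linarith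
  · have h2 := two_mul_ufpN_le_of_lt (lt_of_le_of_lt (by linarith) hlt : ufpN α a < ufpN α c)
    rcases lt_or_eq_of_le h2 with hlt2 | heq2
    · have := four_mul_ufpN_le_of_lt hlt2; linarith
    · have hlt3 : ufpN α b < ufpN α a := by linarith
      have := two_mul_ufpN_le_of_lt hlt3; linarith

/-! ### Root quantities of an evaluation tree -/

/-- `ufpN 0 = 0`. [folklore] -/
theorem ufpN_zero (α : Format) : ufpN α 0 = 0 := by
  unfold ufpN
  rw [if_pos]
  rw [abs_zero]
  exact mul_pos (by positivity) α.quantum_pos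

/-- The root's exact argument (`0` for a leaf). [folklore] -/
def rootArg (α : Format) : SumTree → ℚ
  | .leaf _ => 0
  | .node l r => SumTree.eval (flα α) l + SumTree.eval (flα α) r

/-- `u · ufpN` of the root's exact argument (`0` for a leaf): the paper's `b_r` with `b = ε = u`.
[cite: LangeRump2018, Thm 7] -/
noncomputable def rootB (α : Format) (t : SumTree) : ℚ := α.unitRoundoff * ufpN α (rootArg α t)

/-- `rootB (leaf x) = 0`. [folklore] -/
theorem rootB_leaf (x : ℚ) : rootB α (.leaf x) = 0 := by
  simp [rootB, rootArg, ufpN_zero]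

/-- `rootB ≥ 0`. [folklore] -/
theorem rootB_nonneg (t : SumTree) : 0 ≤ rootB α t :=
  mul_nonneg α.unitRoundoff_pos.le (ufpN_nonneg α _)

/-- TWO-LEVEL BOUND: a tree of height `≤ H + 1` whose grandchildren subtrees obey the weak bound
`D ≤ (H-... )` — stated as: if every proper subtree `c` of height `≤ H` satisfies
`absErr c ≤ H·u·absSum c`, then `absErr t ≤ rootB t + H·u·absSum t`. [cite: LangeRump2018, Thm 7] -/
theorem absErr_le_rootB_add (hα : 2 ≤ α.emaxCode) {H : ℚ} (hH : 0 ≤ H) :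
    ∀ t : SumTree, TreeInRange α t →
      (∀ c : SumTree, TreeInRange α c → treeHeight c + 1 ≤ treeHeight t →
          absErr (flα α) c ≤ H * α.unitRoundoff * absSum c) →
      absErr (flα α) t ≤ rootB α t + H * α.unitRoundoff * absSum t
  | .leaf x, _, _ => by
      simp only [absErr, SumTree.localErrors, List.map_nil, List.sum_nil, rootB_leaf, zero_add, absSum,
        SumTree.leaves, List.map_cons, List.map_nil, List.sum_cons, List.sum_nil, add_zero]
      exact mul_nonneg (mul_nonneg hH α.unitRoundoff_pos.le) (abs_nonneg x)
  | .node l r, ⟨hl, hr, hrange⟩, hsub => by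
      have cl := hsub l hl (by simp only [treeHeight]; omega)
      have cr := hsub r hr (by simp only [treeHeight]; omega)
      obtain ⟨yl, hyl⟩ := exists_toRat_eq_eval l hl
      obtain ⟨yr, hyr⟩ := exists_toRat_eq_eval r hr
      have hrange' : |yl.toRat + yr.toRat| ≤ α.maxRat := by rw [hyl, hyr]; exact hrange
      set e := |flα α (SumTree.eval (flα α) l + SumTree.eval (flα α) r)
        - (SumTree.eval (flα α) l + SumTree.eval (flα α) r)| with he_def
      have he : e ≤ rootB α (.node l r) := by
        have := abs_err_roundNE_add_le_ufpN hα yl yr hrange'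
        rw [hyl, hyr] at this
        exact this
      rw [absErr_node, absSum_node]
      change absErr (flα α) l + absErr (flα α) r + e ≤ _
      linarith

/-! ### The Lange–Rump height induction [LangeRump2018, Thm 7, proof of (25)] -/

/-- THE HEIGHT INDUCTION with the strengthened hypothesis (25) of [LangeRump2018, Thm 7] (binary
trees, radix 2, `c_h = 1/4`, `ε = b = u`, `b_j = u·ufpN(argument of j)`): for every `η` with
`(η+1)²·u ≤ 1`, every `H ≤ η` and every in-range evaluation tree `t` of height `≤ H`,
`Σ|e_v| ≤ H·u·Σ|xᵢ| - (η - H)·max(rootB t - u·Σ|xᵢ|, 0)`. [cite: LangeRump2018, Thm 7] -/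
theorem langeRump_height_induction (hα : 2 ≤ α.emaxCode) {η : ℚ}
    (hη : (η + 1) ^ 2 * α.unitRoundoff ≤ 1) :
    ∀ H : ℕ, ∀ t : SumTree, TreeInRange α t → treeHeight t ≤ H → (H : ℚ) ≤ η →
      absErr (flα α) t ≤ (H : ℚ) * α.unitRoundoff * absSum t
        - (η - H) * max (rootB α t - α.unitRoundoff * absSum t) 0 := by
  intro H
  induction H using Nat.strong_induction_on with
  | _ H ih =>
    intro t ht hH hHη
    have hu := α.unitRoundoff_pos
    set u := α.unitRoundoff with hu_def
    cases t with
    | leaf x =>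
        have hT : 0 ≤ absSum (.leaf x) := absSum_nonneg _
        have hmax : max (rootB α (.leaf x) - u * absSum (.leaf x)) 0 = 0 :=
          max_eq_right (by rw [rootB_leaf]; nlinarith)
        rw [hmax, mul_zero, sub_zero]
        simp only [absErr, SumTree.localErrors, List.map_nil, List.sum_nil]
        exact mul_nonneg (mul_nonneg (Nat.cast_nonneg H) hu.le) hT
    | node p q =>
        obtain ⟨hp, hq, hrange⟩ := ht
        -- H ≥ 1
        have hH1 : 1 ≤ H := by simp [treeHeight] at hH; omega
        have hpH : treeHeight p ≤ H - 1 := by simp [treeHeight] at hH; omega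
        have hqH : treeHeight q ≤ H - 1 := by simp [treeHeight] at hH; omega
        have hcast : ((H - 1 : ℕ) : ℚ) = (H : ℚ) - 1 := by
          rw [Nat.cast_sub hH1]; simp
        have hH1η : (((H - 1 : ℕ) : ℚ)) ≤ η := by rw [hcast]; linarith
        -- IH (strong form) for the children at H - 1
        have ihp := ih (H - 1) (by omega) p hp hpH hH1η
        have ihq := ih (H - 1) (by omega) q hq hqH hH1η
        rw [hcast] at ihp ihq
        set Dp := absErr (flα α) p
        set Dq := absErr (flα α) q
        set Tp := absSum p
        set Tq := absSum q
        set bp := rootB α p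
        set bq := rootB α q
        have hDp := absErr_nonneg (flα α) p
        have hDq := absErr_nonneg (flα α) q
        have hTp := absSum_nonneg p
        have hTq := absSum_nonneg q
        have hbp := rootB_nonneg (α := α) p
        have hbq := rootB_nonneg (α := α) q
        have hηH : 0 ≤ η - ((H : ℚ) - 1) := by linarith
        -- weak forms
        have wp : Dp ≤ ((H : ℚ) - 1) * u * Tp :=
          le_trans ihp (sub_le_self _ (mul_nonneg hηH (le_max_right _ _)))
        have wq : Dq ≤ ((H : ℚ) - 1) * u * Tq :=
          le_trans ihq (sub_le_self _ (mul_nonneg hηH (le_max_right _ _)))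
        -- root data
        obtain ⟨yl, hyl⟩ := exists_toRat_eq_eval p hp
        obtain ⟨yr, hyr⟩ := exists_toRat_eq_eval q hq
        have hrange' : |yl.toRat + yr.toRat| ≤ α.maxRat := by rw [hyl, hyr]; exact hrange
        set y := SumTree.eval (flα α) p + SumTree.eval (flα α) q with hy_def
        set e := |flα α y - y| with he_def
        set br := rootB α (.node p q) with hbr_def
        have hbr_eq : br = u * ufpN α y := rfl
        have he_br : e ≤ br := by
          have := abs_err_roundNE_add_le_ufpN hα yl yr hrange'
          rw [hyl, hyr] at this; exact this
        have hEnode : absErr (flα α) (.node p q) = Dp + Dq + e := absErr_node _ _ _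
        have hTnode : absSum (.node p q) = Tp + Tq := absSum_node _ _
        -- (28): br - u T ≤ u (Dp + Dq) ≤ (H-1) u² T
        have h28 : br - u * (Tp + Tq) ≤ u * (Dp + Dq) := by
          have h1 : ufpN α y ≤ |y| := ufpN_le_abs y
          have h2 : |y| ≤ |SumTree.exact p + SumTree.exact q| + Dp + Dq := by
            have : y = (SumTree.exact p + SumTree.exact q)
                + ((SumTree.eval (flα α) p - SumTree.exact p)
                  + (SumTree.eval (flα α) q - SumTree.exact q)) := by rw [hy_def]; ring
            rw [this]
            refine le_trans (abs_add_le _ _) ?_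
            have h3 := abs_add_le (SumTree.eval (flα α) p - SumTree.exact p)
              (SumTree.eval (flα α) q - SumTree.exact q)
            have h4 := abs_eval_sub_exact_le (flα α) p
            have h5 := abs_eval_sub_exact_le (flα α) q
            linarith
          have h3 : |SumTree.exact p + SumTree.exact q| ≤ Tp + Tq := by
            rw [← absSum_node]; exact abs_exact_le_absSum (.node p q)
          have h4 : ufpN α y ≤ Tp + Tq + (Dp + Dq) := by linarith
          have h5 := mul_le_mul_of_nonneg_left h4 hu.le
          rw [hbr_eq]
          linarith
        rw [hEnode, hTnode]
        by_cases hc1 : br ≤ u * (Tp + Tq)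
        · -- Case 1: the root floor is below u·T
          have hmax : max (br - u * (Tp + Tq)) 0 = 0 := max_eq_right (by linarith)
          rw [hmax, mul_zero, sub_zero]
          linarith
        · have hX : 0 < br - u * (Tp + Tq) := by linarith
          have hmax : max (br - u * (Tp + Tq)) 0 = br - u * (Tp + Tq) := max_eq_left hX.le
          rw [hmax]
          by_cases hc2 : br ≤ bp + bq
          · -- Case 2: use the strong IH of both children
            have m1 : bp - u * Tp ≤ max (bp - u * Tp) 0 := le_max_left _ _
            have m2 : bq - u * Tq ≤ max (bq - u * Tq) 0 := le_max_left _ _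
            have key : Dp + Dq ≤ ((H : ℚ) - 1) * u * (Tp + Tq)
                - (η - ((H : ℚ) - 1)) * (br - u * (Tp + Tq)) := by
              have : (η - ((H : ℚ) - 1)) * (br - u * (Tp + Tq))
                  ≤ (η - ((H : ℚ) - 1)) * (max (bp - u * Tp) 0 + max (bq - u * Tq) 0) :=
                mul_le_mul_of_nonneg_left (by linarith) hηH
              linarith
            linarith
          · -- Case 3: the children's floors sum below the root's: discreteness
            have hc2' : bp + bq < br := not_le.mp hc2
            -- H ≥ 2 (else Dp = Dq = 0 contradicts br > uT via h28)
            have hDpq : br - u * (Tp + Tq) ≤ ((H : ℚ) - 1) * u * u * (Tp + Tq) := by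
              have := mul_le_mul_of_nonneg_left (add_le_add wp wq) hu.le
              linarith
            have hH2 : 2 ≤ H := by
              by_contra hlt
              have hH1' : H = 1 := by omega
              subst hH1'
              simp at hDpq
              linarith
            have hcast2 : ((H - 2 : ℕ) : ℚ) = (H : ℚ) - 2 := by rw [Nat.cast_sub hH2]; simp
            -- two-level bounds for the children via the weak IH at H - 2
            have two : ∀ c : SumTree, TreeInRange α c → treeHeight c ≤ H - 1 →
                absErr (flα α) c ≤ rootB α c + ((H : ℚ) - 2) * u * absSum c := by
              intro c hc hch
              refine absErr_le_rootB_add hα (by linarith) c hc (fun c' hc' hh' => ?_)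
              have := ih (H - 2) (by omega) c' hc' (by omega) (by rw [hcast2]; linarith)
              rw [hcast2] at this
              exact le_trans this (sub_le_self _ (mul_nonneg (by linarith) (le_max_right _ _)))
            have tp := two p hp hpH
            have tq := two q hq hqH
            -- discreteness: bp + bq ≤ 3/4 br
            have h27 : bp + bq ≤ 3 / 4 * br := by
              have hlt : ufpN α (rootArg α p) + ufpN α (rootArg α q) < ufpN α y := by
                have h' : u * (ufpN α (rootArg α p) + ufpN α (rootArg α q)) < u * ufpN α y := by
                  rw [mul_add]; exact hc2'
                exact lt_of_mul_lt_mul_left h' hu.le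
              have := mul_le_mul_of_nonneg_left (ufpN_add_ufpN_le_of_lt hlt) hu.le
              rw [hbr_eq]
              change u * ufpN α (rootArg α p) + u * ufpN α (rootArg α q) ≤ _
              linarith
            -- AM-GM: (η - H + 2)(H - 1) u ≤ (η+1)² u / 4 ≤ 1/4
            have amgm : (η - H + 2) * ((H : ℚ) - 1) * u ≤ 1 / 4 := by
              have h0 : (η + 1) ^ 2 / 4 - (η - H + 2) * ((H : ℚ) - 1)
                  = ((η - H + 2) - ((H : ℚ) - 1)) ^ 2 / 4 := by ring
              have h1 : (η - H + 2) * ((H : ℚ) - 1) ≤ (η + 1) ^ 2 / 4 := by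
                have := sq_nonneg ((η - H + 2) - ((H : ℚ) - 1))
                linarith
              calc (η - H + 2) * ((H : ℚ) - 1) * u ≤ (η + 1) ^ 2 / 4 * u :=
                    mul_le_mul_of_nonneg_right h1 hu.le
                _ ≤ 1 / 4 := by linarith
            have hT0 : 0 ≤ Tp + Tq := add_nonneg hTp hTq
            -- D ≤ br + (bp + bq) + (H-2) u T ≤ 7/4 br + (H-2) u T, and (7/4 + η - H) X ≤ u T / 4
            have hfin : (7 / 4 + η - H) * (br - u * (Tp + Tq)) ≤ u * (Tp + Tq) / 4 := by
              have hc : 0 ≤ 7 / 4 + η - (H : ℚ) := by linarith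
              have hH1' : (1 : ℚ) ≤ H := by exact_mod_cast hH1
              have hHu : (0 : ℚ) ≤ ((H : ℚ) - 1) * u := mul_nonneg (by linarith) hu.le
              calc (7 / 4 + η - H) * (br - u * (Tp + Tq))
                  ≤ (7 / 4 + η - H) * (((H : ℚ) - 1) * u * u * (Tp + Tq)) :=
                    mul_le_mul_of_nonneg_left hDpq hc
                _ = ((η - H + 7 / 4) * (((H : ℚ) - 1) * u)) * (u * (Tp + Tq)) := by ring
                _ ≤ ((η - H + 2) * (((H : ℚ) - 1) * u)) * (u * (Tp + Tq)) := by
                    apply mul_le_mul_of_nonneg_right _ (mul_nonneg hu.le hT0)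
                    exact mul_le_mul_of_nonneg_right (by linarith) hHu
                _ ≤ (1 / 4) * (u * (Tp + Tq)) := by
                    apply mul_le_mul_of_nonneg_right _ (mul_nonneg hu.le hT0)
                    have : (η - H + 2) * (((H : ℚ) - 1) * u) = (η - H + 2) * ((H : ℚ) - 1) * u := by
                      ring
                    rw [this]; exact amgm
                _ = u * (Tp + Tq) / 4 := by ring
            have hsum : Dp + Dq + e ≤ br + (bp + bq) + ((H : ℚ) - 2) * u * (Tp + Tq) := by
              have : Dp + Dq ≤ bp + ((H : ℚ) - 2) * u * Tp + (bq + ((H : ℚ) - 2) * u * Tq) :=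
                add_le_add tp tq
              linarith
            linarith

/-- LANGE–RUMP HEIGHT BOUND FOR THE FORMATS, local-error form [BoldoEtAl2023, Thm 4.4] =
[LangeRump2018, Prop 3] (round-to-nearest case): for every format `α` with `emaxCode ≥ 2` and every
evaluation tree with leaves in `F_α`, nodes in range and height `h` with `(h+1)²·u ≤ 1`
(i.e. `h ≤ u^{-1/2} - 1`): `Σ|e_v| ≤ h·u·Σ|xᵢ|`. [cite: LangeRump2018, Prop 3] -/
theorem absErr_flα_le_height_langeRump (hα : 2 ≤ α.emaxCode) (t : SumTree) (ht : TreeInRange α t)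
    (hh : ((treeHeight t : ℚ) + 1) ^ 2 * α.unitRoundoff ≤ 1) :
    absErr (flα α) t ≤ (treeHeight t : ℚ) * α.unitRoundoff * absSum t := by
  have := langeRump_height_induction hα (η := treeHeight t) hh (treeHeight t) t ht le_rfl le_rfl
  simpa using this

/-- LANGE–RUMP HEIGHT BOUND (R2, any order — pairwise summation `h = ⌈log₂ n⌉`, blocked orders):
`|ŝ - s| ≤ h·u·Σ|xᵢ|` whenever `(h+1)²·u ≤ 1`, replacing `(1+u)^h - 1` of `AccumulateTree.lean`
by its linear term. Statement: Lange–Rump [LangeRump2018, Prop 3], quoted as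
[BoldoEtAl2023, Thm 4.4]; proof: the paper's Theorem 7 induction, formalised here with
`b_j = u·ufpN(argument)`. [cite: LangeRump2018, Prop 3] -/
theorem abs_eval_sub_exact_le_height_langeRump (hα : 2 ≤ α.emaxCode) (t : SumTree)
    (ht : TreeInRange α t) (hh : ((treeHeight t : ℚ) + 1) ^ 2 * α.unitRoundoff ≤ 1) :
    |SumTree.eval (flα α) t - SumTree.exact t|
      ≤ (treeHeight t : ℚ) * α.unitRoundoff * absSum t :=
  le_trans (abs_eval_sub_exact_le (flα α) t) (absErr_flα_le_height_langeRump hα t ht hh)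

end MiniFloat

end Literature.ComputerArithmetic.FloatingPoint
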